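import Summits.QuantumFields.BalabanUV.T4Continuum.Support.ScalarCovariantCoercive
import Summits.QuantumFields.BalabanUV.T4Continuum.Support.CovariantBlockAveraging

/-!
# T⁴ programme, SUBSTRATE (shared lattice-gauge analysis library) — LEVEL-FREE COERCIVITY OF THE COVARIANT VECTOR OPERATOR
# `V_R = Δ_R + a′·n^d·Q_k(R)ᴴQ_k(R)` (the (3.24)-TYPE OPERATOR WITHOUT THE GAUGE TERM; p1's `SubstrateCovariantAveraging.deltaQOf c a Γ U`
# at `c = n`, `a = a′·n^d`, `R = transV … U`), its invertibility and the norm of its inverse — junction J-1 of MAP v0.4 §O1 O-3′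
# («`greenOf := (deltaQOf c a Γ U)⁻¹`, invertibility displayed ⇒ discharged here at regular backgrounds»)

Substrate cell `b2b-balaban-substrate-*`, seat p3 (typer NEXT v0.4 item 2).  Objects: the covariant vector Laplacian with colour transporters
`Δ_R = Σ_ν (∇^R_ν)ᴴ∇^R_ν` on `(Tor (fine n M) × Fin d) × o` (`ColourCovariantLaplacian.covLapC`, `∇^R_ν = n·(siteMul(R_ν)·(S_ν ⊗ 1) − 1)`),
the covariant `k`-fold block averaging `Q_k(R) = CovariantBlockAveraging.Qcov n M Γ R` along a contour system `Γ`, and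
**`vecOp n M a′ Γ R = Δ_R + (a′·n^d)·Q_k(R)ᴴQ_k(R)`** — with the printed normalisation `Q* = n^dQᴴ` of [Balaban1984PropagatorsI] (1.18)∕(1.69)
(so that the mass term is `a′·Q*Q`; p1's `deltaQOf c a Γ U` is `vecOp` at `a = a′·n^d`, `c = n`, `R = transV … U` — junction file J-3).
 * §1 stacking ([folklore]): `stackM X` (the column operator `v ↦ (X_ν v)_ν`), `stackM_conjTranspose_mul_stackM` (`= Σ_ν X_νᴴX_ν`), `nsq_stackM_mulVec`,
   `opNorm_stackM_le` (`≤ √d·α`); hence `covLapC = (stackM ∇^R)ᴴ(stackM ∇^R)` (`covLapC_eq_gram`).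
 * §2 the FREE operator: `covLapC_const_one` (`Δ_1 = Δ ⊗ 1`), **`vecOp_one`**: `vecOp n M a′ Γ 1 = (Lap + a′·QvAdj·QvOp) ⊗ 1`, and
   **`coercive_freeVec`**: `Coercive (gammaA d a′) (Lap n M + a′•(QvAdj n M * QvOp n M))` — because `Lap + a′Q*Q = Δ_{a′} + ∂PcT∂ᴴ`
   (`B5DeltaA169.DeltaA`) with `∂PcT∂ᴴ = (PcT∂ᴴ)ᴴ(PcT∂ᴴ) ⪰ 0` (`B5Value126.PcT_mul_PcT`∕`PcT_conjTranspose`) and `Δ_{a′}` is `gammaA`-coercive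
   (`Beta.DeltaACombesThomas.re_form_DeltaA_ge`, the kernel (1.90)); lifted to colour by `GaugeTermCoercivity.coercive_kron_one`.
 * §3 the BACKGROUND operator by Gram perturbation (`GaugeTermCoercivity.coercive_gram_perturb`): with `‖n(R_ν(i) − 1)‖ ≤ α` (small field in
   lattice units) and `‖T(Γ) − 1‖ ≤ τ` for the contour transports, `‖stackM(∇^R − ∇⊗1)‖ ≤ √d·α` (`opNorm_gradDefect_le`) and
   `‖a′n^d(Q_k(R)ᴴQ_k(R) − (Q⊗1)ᴴ(Q⊗1))‖ ≤ a′·card o·τ·(2 + card o·τ)` (`opNorm_massDefect_le`, from `opNorm_Qcov_sub_kron_le` and `opNorm_QvOp_le` —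
   the `n^d` against the two `n^{−d/2}`), whence **`coercive_vecOp`**: `Coercive (gammaV (card o) d a′ α τ) (vecOp n M a′ Γ R)`,
   `gammaV co d a′ α τ = gammaA d a′/2 − d·α² − a′·co·τ·(2 + co·τ)` — FREE OF `n = L^k` AND OF THE TORUS; `vecOp_isHermitian`,
   **`isUnit_vecOp`**, **`opNorm_vecOp_inv_le`** (`‖V_R⁻¹‖ ≤ 1/gammaV` when `gammaV > 0`).
What is NOT here: the row defects and the decay of `V_R⁻¹` (J-2∕J-3), the reading at a V1 gauge field (J-3), the gauge term `DR(U)D*` of [B9] (3.26)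
(programme VEC).

HONEST FRAMING (T4-DAG p. 1).  MODEL-level linear algebra ([folklore]; one region, global small field, constants OURS and crude); the printed (1.90) is
used only through the tree's kernel theorem `re_form_DeltaA_ge`; nothing printed is a hypothesis; no `def … : Prop`; spine 0/9 unchanged; NOT infinite
volume ∕ mass gap ∕ Clay.  HONEST DEPENDENCY: continuum YM on T⁴ ⇐ BetaPertH ∧ nine spine estimates (0/9 proved); BetaPertH ⇐ (D1) ∧ (D4) ∧ CAP+tail;
G-an2-4 gates asym, D1 and NE2/3/4.  ABSOLUTE RULE kept; no `sorry`.
-/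

noncomputable section

open scoped BigOperators ComplexConjugate Matrix Matrix.Norms.L2Operator Kronecker ComplexOrder

namespace Summit.QuantumFields.BalabanUV.T4Continuum.CovariantVectorCoercive

open Literature.MathematicalPhysics.QuantumFieldTheory.Balaban1983to89.B5Prop11Plancherel (Tor fine unitVec shiftM fdiff)
open Literature.MathematicalPhysics.QuantumFieldTheory.Balaban1983to89.B5Prop11Lower (nsq nsq_nonneg nsq_mulVec_le Lap)
open Literature.MathematicalPhysics.QuantumFieldTheory.Balaban1983to89.B5Action121 (GradOp)
open Literature.MathematicalPhysics.QuantumFieldTheory.Balaban1983to89.B5Block118 (QvOp)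
open Literature.MathematicalPhysics.QuantumFieldTheory.Balaban1983to89.B5Value126 (PcT PcT_mul_PcT PcT_conjTranspose)
open Literature.MathematicalPhysics.QuantumFieldTheory.Balaban1983to89.B5DeltaA169 (QvAdj DeltaA)
open Literature.MathematicalPhysics.QuantumFieldTheory.Balaban1983to89.Beta.DeltaACombesThomas (gammaA gammaA_pos re_form_DeltaA_ge)
open Summit.QuantumFields.BalabanUV.T4Continuum
open Summit.QuantumFields.BalabanUV.T4Continuum.KroneckerLift
open Summit.QuantumFields.BalabanUV.T4Continuum.BlockMultiplication
open Summit.QuantumFields.BalabanUV.T4Continuum.BlockPairingGeometry (opNorm_shiftM_le)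
open Summit.QuantumFields.BalabanUV.T4Continuum.ColourCovariantLaplacian (covDc connM covDc_eq covLapC lapC lapC_eq)
open Summit.QuantumFields.BalabanUV.T4Continuum.CovariantBlockAveraging (transport ContourSystem Qcov Qcov_one opNorm_Qcov_sub_kron_le opNorm_QvOp_le)
open Summit.QuantumFields.BalabanUV.T4Continuum.ScalarAveragedPropagator (opNorm_le_of_nsq_le_rect)
open Summit.QuantumFields.BalabanUV.T4Continuum.CoerciveInverseTower (Coercive isUnit_of_coercive opNorm_inv_le_of_coercive)
open Summit.QuantumFields.BalabanUV.T4Continuum.GaugeTermCoercivity (coercive_gram_perturb coercive_kron_one nsq_mulVec_le_rect)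

variable {d : ℕ} {o : Type*} [Fintype o] [DecidableEq o]

/-! ## §1 Stacking a family of kernels -/

section Stack

variable {σ : Type*}

/-- **stacking**: the column operator `v ↦ (X_ν v)_ν` of a family `X : Fin d → Matrix σ σ ℂ`, as a matrix `(σ × Fin d) × σ`. [folklore] -/
def stackM (X : Fin d → Matrix σ σ ℂ) : Matrix (σ × Fin d) σ ℂ := Matrix.of fun i j => X i.2 i.1 j

/-- entries. [folklore] -/
theorem stackM_apply (X : Fin d → Matrix σ σ ℂ) (i : σ × Fin d) (j : σ) : stackM X i j = X i.2 i.1 j := rfl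

/-- stacking is additive. [folklore] -/
theorem stackM_add (X Y : Fin d → Matrix σ σ ℂ) : stackM (fun ν => X ν + Y ν) = stackM X + stackM Y := by
  ext i j; rfl

/-- stacking respects subtraction. [folklore] -/
theorem stackM_sub (X Y : Fin d → Matrix σ σ ℂ) : stackM (fun ν => X ν - Y ν) = stackM X - stackM Y := by
  ext i j; rfl

variable [Fintype σ]

/-- `(stackM X v)(x, ν) = (X_ν v)(x)`. [folklore] -/
theorem stackM_mulVec_apply (X : Fin d → Matrix σ σ ℂ) (v : σ → ℂ) (i : σ × Fin d) : (stackM X *ᵥ v) i = (X i.2 *ᵥ v) i.1 := rfl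

/-- **`(stackM X)ᴴ·stackM X = Σ_ν X_νᴴX_ν`**. [folklore] -/
theorem stackM_conjTranspose_mul_stackM (X : Fin d → Matrix σ σ ℂ) : (stackM X)ᴴ * stackM X = ∑ ν, (X ν)ᴴ * X ν := by
  ext x y
  simp only [Matrix.mul_apply, Matrix.conjTranspose_apply, stackM_apply, Matrix.sum_apply, Fintype.sum_prod_type]
  rw [Finset.sum_comm]

/-- `‖stackM X v‖² = Σ_ν ‖X_ν v‖²`. [folklore] -/
theorem nsq_stackM_mulVec (X : Fin d → Matrix σ σ ℂ) (v : σ → ℂ) : nsq (stackM X *ᵥ v) = ∑ ν, nsq (X ν *ᵥ v) := by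
  simp only [nsq, Fintype.sum_prod_type, stackM_mulVec_apply]
  rw [Finset.sum_comm]

/-- **`‖stackM X‖ ≤ √d·α`** when every `‖X_ν‖ ≤ α`. [folklore] -/
theorem opNorm_stackM_le [DecidableEq σ] (X : Fin d → Matrix σ σ ℂ) {α : ℝ} (hα : 0 ≤ α) (h : ∀ ν, ‖X ν‖ ≤ α) :
    ‖stackM X‖ ≤ Real.sqrt d * α := by
  refine opNorm_le_of_nsq_le_rect _ (by positivity) fun v => ?_
  rw [nsq_stackM_mulVec, mul_pow, Real.sq_sqrt (Nat.cast_nonneg _)]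
  calc ∑ ν, nsq (X ν *ᵥ v) ≤ ∑ _ν : Fin d, α ^ 2 * nsq v := Finset.sum_le_sum fun ν _ =>
        (nsq_mulVec_le (X ν) v).trans (mul_le_mul_of_nonneg_right (pow_le_pow_left₀ (norm_nonneg _) (h ν) 2) (nsq_nonneg _))
    _ = d * α ^ 2 * nsq v := by rw [Finset.sum_const, Finset.card_univ, Fintype.card_fin, nsmul_eq_mul]; ring

end Stack

/-! ## §2 The operator, its free value and the free coercivity -/

section Operator

variable (n : ℕ) [NeZero n] (M : Fin d → ℕ) [hM : ∀ μ, NeZero (M μ)]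

/-- `Δ_R = (stackM ∇^R)ᴴ(stackM ∇^R)` — the covariant vector Laplacian as ONE Gram matrix. [folklore] -/
theorem covLapC_eq_gram (c : ℂ) (R : Fin d → (Tor (fine n M) × Fin d → Matrix o o ℂ)) :
    covLapC (fine n M) c R = (stackM (covDc (fine n M) c R))ᴴ * stackM (covDc (fine n M) c R) := by
  rw [stackM_conjTranspose_mul_stackM]; rfl

/-- **THE COVARIANT VECTOR OPERATOR WITHOUT THE GAUGE TERM** `V_R = Δ_R + (a′·n^d)·Q_k(R)ᴴQ_k(R)` (mass in the printed normalisation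
`a′·Q*Q`, `Q* = n^dQᴴ`). [folklore] -/
def vecOp (a' : ℝ) (Γ : ContourSystem d n M) (R : Fin d → (Tor (fine n M) × Fin d → Matrix o o ℂ)) :
    Matrix ((Tor (fine n M) × Fin d) × o) ((Tor (fine n M) × Fin d) × o) ℂ :=
  covLapC (fine n M) ((n : ℕ) : ℂ) R + ((a' * (n : ℝ) ^ d : ℝ) : ℂ) • ((Qcov n M Γ R)ᴴ * Qcov n M Γ R)

/-- at the trivial transporters the covariant difference is the free one lifted to colour: `∇^1_ν = ∇_ν ⊗ 1`. [folklore] -/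
theorem covDc_const_one (c : ℂ) (ν : Fin d) :
    covDc (fine n M) c (fun _ _ => (1 : Matrix o o ℂ)) ν = fdiff (fine n M) c ν ⊗ₖ (1 : Matrix o o ℂ) := by
  rw [covDc, fdiff, Matrix.smul_kronecker, sub_kronecker, Matrix.one_kronecker_one]
  congr 2
  rw [show (fun _ : Tor (fine n M) × Fin d => (1 : Matrix o o ℂ)) = fun _ => 1 from rfl, siteMul_one, Matrix.one_mul]

/-- `Δ_1 = Δ ⊗ 1`. [folklore] -/
theorem covLapC_const_one (c : ℂ) : covLapC (fine n M) c (fun _ _ => (1 : Matrix o o ℂ)) = lapC (fine n M) c := by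
  unfold covLapC lapC
  exact Finset.sum_congr rfl fun ν _ => by rw [covDc_const_one]

/-- `Δ⊗1` written with the printed `Lap`: `lapC (fine n M) n = Lap n M ⊗ 1`. [folklore] -/
theorem lapC_eq_Lap_kron : lapC (fine n M) ((n : ℕ) : ℂ) = Lap n M ⊗ₖ (1 : Matrix o o ℂ) := by
  rw [lapC_eq]; rfl

omit [NeZero n] hM in
/-- the real scalar `a′·n^d` as `a′ • n^d` in `ℂ`. [folklore] -/
theorem massCoeff_eq (a' : ℝ) : (((a' * (n : ℝ) ^ d : ℝ) : ℂ)) = (a' : ℂ) * ((n : ℕ) : ℂ) ^ d := by push_cast; ring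

/-- **THE FREE VALUE**: `vecOp n M a′ Γ 1 = (Lap + a′·QvAdj·QvOp) ⊗ 1` for every contour system. [folklore] -/
theorem vecOp_one (a' : ℝ) (Γ : ContourSystem d n M) :
    vecOp n M a' Γ (fun _ _ => (1 : Matrix o o ℂ)) = (Lap n M + (a' : ℂ) • (QvAdj n M * QvOp n M)) ⊗ₖ (1 : Matrix o o ℂ) := by
  rw [vecOp, covLapC_const_one, lapC_eq_Lap_kron, Qcov_one, kron_conjTranspose, ← kron_mul, QvAdj, Matrix.smul_mul, smul_smul,
    Matrix.add_kronecker, Matrix.smul_kronecker, massCoeff_eq]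

/-- `Lap + a′·Q*Q = Δ_{a′} + ∂·PcT·∂ᴴ` (the definition of `B5DeltaA169.DeltaA`, rearranged). [folklore] -/
theorem Lap_add_mass_eq (a' : ℝ) :
    Lap n M + (a' : ℂ) • (QvAdj n M * QvOp n M)
      = DeltaA n M a' + GradOp (fine n M) (n : ℂ) * PcT n M (n : ℂ) * (GradOp (fine n M) (n : ℂ))ᴴ := by
  rw [DeltaA]; abel

/-- `∂·PcT·∂ᴴ = (PcT∂ᴴ)ᴴ(PcT∂ᴴ)` (`PcT` is an orthogonal projection). [folklore] -/
theorem gaugeTerm_eq_gram :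
    GradOp (fine n M) (n : ℂ) * PcT n M (n : ℂ) * (GradOp (fine n M) (n : ℂ))ᴴ
      = (PcT n M (n : ℂ) * (GradOp (fine n M) (n : ℂ))ᴴ)ᴴ * (PcT n M (n : ℂ) * (GradOp (fine n M) (n : ℂ))ᴴ) := by
  have hc : ((n : ℕ) : ℂ) ≠ 0 := by exact_mod_cast NeZero.ne n
  rw [Matrix.conjTranspose_mul, Matrix.conjTranspose_conjTranspose, PcT_conjTranspose,
    ← Matrix.mul_assoc (GradOp (fine n M) (n : ℂ) * PcT n M (n : ℂ)) (PcT n M (n : ℂ)) _,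
    Matrix.mul_assoc (GradOp (fine n M) (n : ℂ)) (PcT n M (n : ℂ)) (PcT n M (n : ℂ)), PcT_mul_PcT n M (n : ℂ) hc]

/-- `∂·PcT·∂ᴴ ⪰ 0`. [folklore] -/
theorem gaugeTerm_posSemidef : (GradOp (fine n M) (n : ℂ) * PcT n M (n : ℂ) * (GradOp (fine n M) (n : ℂ))ᴴ).PosSemidef := by
  rw [gaugeTerm_eq_gram]; exact Matrix.posSemidef_conjTranspose_mul_self _

variable {a' : ℝ}

/-- **FREE COERCIVITY** `Coercive (gammaA d a′) (Lap + a′·Q*Q)`: `Re⟨A, (Δ_{a′} + ∂PcT∂ᴴ)A⟩ ≥ gammaA·‖A‖² + 0` (kernel (1.90) + positivity of the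
gauge term); uniform in `n` and the torus. [folklore] -/
theorem coercive_freeVec (ha' : 0 < a') : Coercive (gammaA d a') (Lap n M + (a' : ℂ) • (QvAdj n M * QvOp n M)) := by
  have hn : 1 ≤ n := Nat.one_le_iff_ne_zero.mpr (NeZero.ne n)
  intro A
  rw [Lap_add_mass_eq, Matrix.add_mulVec, dotProduct_add, Complex.add_re]
  have h1 := re_form_DeltaA_ge n hn M a' ha' A
  have h2 : 0 ≤ (star A ⬝ᵥ ((GradOp (fine n M) (n : ℂ) * PcT n M (n : ℂ) * (GradOp (fine n M) (n : ℂ))ᴴ) *ᵥ A)).re := by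
    simpa using (gaugeTerm_posSemidef n M).re_dotProduct_nonneg A
  linarith

/-- the free VECTOR operator is `gammaA`-coercive on colour fields: `Coercive (gammaA d a′) (vecOp n M a′ Γ 1)`. [folklore] -/
theorem coercive_vecOp_one (ha' : 0 < a') (Γ : ContourSystem d n M) : Coercive (gammaA d a') (vecOp n M a' Γ (fun _ _ => (1 : Matrix o o ℂ))) := by
  rw [vecOp_one]; exact coercive_kron_one (coercive_freeVec n M ha')

end Operator

/-! ## §3 Coercivity at a regular background -/

section Background

variable (n : ℕ) [NeZero n] (M : Fin d → ℕ) [hM : ∀ μ, NeZero (M μ)]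
variable {a' α τ : ℝ} {Γ : ContourSystem d n M} {R : Fin d → (Tor (fine n M) × Fin d → Matrix o o ℂ)}

/-- the free stacked gradient `stackM (∇ ⊗ 1)`. [folklore] -/
def freeGrad : Matrix (((Tor (fine n M) × Fin d) × o) × Fin d) ((Tor (fine n M) × Fin d) × o) ℂ :=
  stackM fun ν => fdiff (fine n M) ((n : ℕ) : ℂ) ν ⊗ₖ (1 : Matrix o o ℂ)

/-- the gradient defect `stackM (∇^R − ∇ ⊗ 1) = stackM (siteMul(w_ν)·(S_ν ⊗ 1))`, `w_ν = n(R_ν − 1)`. [folklore] -/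
def gradDefect (R : Fin d → (Tor (fine n M) × Fin d → Matrix o o ℂ)) :
    Matrix (((Tor (fine n M) × Fin d) × o) × Fin d) ((Tor (fine n M) × Fin d) × o) ℂ :=
  stackM fun ν => siteMul (connM (fine n M) ((n : ℕ) : ℂ) R ν) * shiftM (fine n M) ν ⊗ₖ (1 : Matrix o o ℂ)

/-- `stackM ∇^R = freeGrad + gradDefect`. [folklore] -/
theorem stackM_covDc_eq (R : Fin d → (Tor (fine n M) × Fin d → Matrix o o ℂ)) :
    stackM (covDc (fine n M) ((n : ℕ) : ℂ) R) = freeGrad n M + gradDefect n M R := by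
  rw [freeGrad, gradDefect, ← stackM_add]
  congr 1
  funext ν
  exact covDc_eq (fine n M) ((n : ℕ) : ℂ) R ν

/-- **`‖gradDefect‖ ≤ √d·α`** when `‖n(R_ν(i) − 1)‖ ≤ α`. [folklore] -/
theorem opNorm_gradDefect_le (hα : 0 ≤ α) (hR : ∀ ν i, ‖connM (fine n M) ((n : ℕ) : ℂ) R ν i‖ ≤ α) : ‖gradDefect n M R‖ ≤ Real.sqrt d * α := by
  refine opNorm_stackM_le _ hα fun ν => ?_
  calc _ ≤ ‖siteMul (connM (fine n M) ((n : ℕ) : ℂ) R ν)‖ * ‖shiftM (fine n M) ν ⊗ₖ (1 : Matrix o o ℂ)‖ := Matrix.l2_opNorm_mul _ _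
    _ ≤ α * 1 := mul_le_mul (opNorm_siteMul_le _ hα (hR ν)) (opNorm_kron_le_of_le o (opNorm_shiftM_le _ ν)) (norm_nonneg _) hα
    _ = α := mul_one α

/-- `lapC = freeGradᴴ·freeGrad`. [folklore] -/
theorem lapC_eq_gram : lapC (o := o) (fine n M) ((n : ℕ) : ℂ) = (freeGrad n M (o := o))ᴴ * freeGrad n M (o := o) := by
  rw [freeGrad, stackM_conjTranspose_mul_stackM]; rfl

/-- the free mass term `(a′n^d)·(Q⊗1)ᴴ(Q⊗1)` is positive semidefinite (`a′ ≥ 0`). [folklore] -/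
theorem freeMass_posSemidef (ha' : 0 ≤ a') :
    (((a' * (n : ℝ) ^ d : ℝ) : ℂ) • ((QvOp n M ⊗ₖ (1 : Matrix o o ℂ))ᴴ * (QvOp n M ⊗ₖ (1 : Matrix o o ℂ)))).PosSemidef := by
  have hs : 0 ≤ a' * (n : ℝ) ^ d := by positivity
  have h : ((a' * (n : ℝ) ^ d : ℝ) : ℂ) • ((QvOp n M ⊗ₖ (1 : Matrix o o ℂ))ᴴ * (QvOp n M ⊗ₖ (1 : Matrix o o ℂ)))
      = ((((Real.sqrt (a' * (n : ℝ) ^ d) : ℝ) : ℂ)) • (QvOp n M ⊗ₖ (1 : Matrix o o ℂ)))ᴴ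
          * ((((Real.sqrt (a' * (n : ℝ) ^ d) : ℝ) : ℂ)) • (QvOp n M ⊗ₖ (1 : Matrix o o ℂ))) := by
    rw [Matrix.conjTranspose_smul, Matrix.smul_mul, Matrix.mul_smul, smul_smul, Complex.star_def, Complex.conj_ofReal, ← Complex.ofReal_mul,
      Real.mul_self_sqrt hs]
  rw [h]
  exact Matrix.posSemidef_conjTranspose_mul_self _

/-- **the mass defect**: `‖(a′n^d)·(Q_k(R)ᴴQ_k(R) − (Q⊗1)ᴴ(Q⊗1))‖ ≤ a′·card o·τ·(2 + card o·τ)` when the contour transports satisfy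
`‖T(Γ) − 1‖ ≤ τ` (the `n^d` against `‖Q_k(R) − Q⊗1‖, ‖Q‖ = O(n^{−d/2})`). [folklore] -/
theorem opNorm_massDefect_le (ha' : 0 ≤ a') (hτ : 0 ≤ τ) (hT : ∀ y j μ (t : Fin n), ‖transport (fine n M) R μ (Γ y j μ t) - 1‖ ≤ τ) :
    ‖((a' * (n : ℝ) ^ d : ℝ) : ℂ) • ((Qcov n M Γ R)ᴴ * Qcov n M Γ R)
        - ((a' * (n : ℝ) ^ d : ℝ) : ℂ) • ((QvOp n M ⊗ₖ (1 : Matrix o o ℂ))ᴴ * (QvOp n M ⊗ₖ (1 : Matrix o o ℂ)))‖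
      ≤ a' * (Fintype.card o * τ * (2 + Fintype.card o * τ)) := by
  set Qc := Qcov n M Γ R with hQc
  set Q1 := QvOp n M ⊗ₖ (1 : Matrix o o ℂ) with hQ1
  set s : ℝ := Real.sqrt ((n : ℝ) ^ d) with hs
  have hnpos : (0 : ℝ) < (n : ℝ) ^ d := pow_pos (by exact_mod_cast Nat.pos_of_ne_zero (NeZero.ne n)) d
  have hspos : 0 < s := Real.sqrt_pos.mpr hnpos
  have hss : s * s = (n : ℝ) ^ d := Real.mul_self_sqrt hnpos.le
  have hδ : ‖Qc - Q1‖ ≤ Fintype.card o * τ * s⁻¹ := opNorm_Qcov_sub_kron_le n M Γ hτ hT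
  have hQ1n : ‖Q1‖ ≤ s⁻¹ := opNorm_kron_le_of_le o (opNorm_QvOp_le n M)
  have hQcn : ‖Qc‖ ≤ s⁻¹ + Fintype.card o * τ * s⁻¹ := by
    calc ‖Qc‖ = ‖Q1 + (Qc - Q1)‖ := by rw [add_sub_cancel]
      _ ≤ _ := (norm_add_le _ _).trans (add_le_add hQ1n hδ)
  have hdiff : Qcᴴ * Qc - Q1ᴴ * Q1 = (Qc - Q1)ᴴ * Qc + Q1ᴴ * (Qc - Q1) := by
    rw [Matrix.conjTranspose_sub, Matrix.sub_mul, Matrix.mul_sub]; abel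
  have hco : (0 : ℝ) ≤ Fintype.card o := Nat.cast_nonneg _
  rw [← smul_sub, hdiff, norm_smul, Complex.norm_real, Real.norm_of_nonneg (by positivity)]
  calc a' * (n : ℝ) ^ d * ‖(Qc - Q1)ᴴ * Qc + Q1ᴴ * (Qc - Q1)‖
      ≤ a' * (n : ℝ) ^ d * (‖(Qc - Q1)ᴴ‖ * ‖Qc‖ + ‖Q1ᴴ‖ * ‖Qc - Q1‖) :=
        mul_le_mul_of_nonneg_left ((norm_add_le _ _).trans (add_le_add (Matrix.l2_opNorm_mul _ _) (Matrix.l2_opNorm_mul _ _))) (by positivity)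
    _ ≤ a' * (n : ℝ) ^ d * ((Fintype.card o * τ * s⁻¹) * (s⁻¹ + Fintype.card o * τ * s⁻¹) + s⁻¹ * (Fintype.card o * τ * s⁻¹)) := by
        rw [Matrix.l2_opNorm_conjTranspose, Matrix.l2_opNorm_conjTranspose]
        refine mul_le_mul_of_nonneg_left (add_le_add (mul_le_mul hδ hQcn (norm_nonneg _) (by positivity))
          (mul_le_mul hQ1n hδ (norm_nonneg _) (by positivity))) (by positivity)
    _ = a' * (Fintype.card o * τ * (2 + Fintype.card o * τ)) * ((n : ℝ) ^ d * (s⁻¹ * s⁻¹)) := by ring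
    _ = a' * (Fintype.card o * τ * (2 + Fintype.card o * τ)) := by rw [← mul_inv, hss, mul_inv_cancel₀ hnpos.ne', mul_one]

/-- the LEVEL-FREE coercivity constant **`gammaV co d a′ α τ = gammaA d a′/2 − d·α² − a′·co·τ·(2 + co·τ)`**. [folklore] -/
def gammaV (co d : ℕ) (a' α τ : ℝ) : ℝ := gammaA d a' / 2 - d * α ^ 2 - a' * (co * τ * (2 + co * τ))

/-- **COERCIVITY OF `V_R = Δ_R + a′n^dQ_k(R)ᴴQ_k(R)` AT A REGULAR BACKGROUND**: `‖n(R_ν(i) − 1)‖ ≤ α` and `‖T(Γ) − 1‖ ≤ τ` give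
`Coercive (gammaV (card o) d a′ α τ) (vecOp n M a′ Γ R)` — uniformly in `n = L^k` and in the torus (`coercive_gram_perturb` with `S₁ = vecOp … 1`,
`W = gradDefect`, `Y_U − Y_1 = massDefect`). [folklore] -/
theorem coercive_vecOp (ha' : 0 < a') (hα : 0 ≤ α) (hτ : 0 ≤ τ) (hR : ∀ ν i, ‖connM (fine n M) ((n : ℕ) : ℂ) R ν i‖ ≤ α)
    (hT : ∀ y j μ (t : Fin n), ‖transport (fine n M) R μ (Γ y j μ t) - 1‖ ≤ τ) :
    Coercive (gammaV (Fintype.card o) d a' α τ) (vecOp n M a' Γ R) := by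
  have hS₁ : vecOp n M a' Γ (fun _ _ => (1 : Matrix o o ℂ))
      = (freeGrad n M (o := o))ᴴ * freeGrad n M (o := o)
        + ((a' * (n : ℝ) ^ d : ℝ) : ℂ) • ((QvOp n M ⊗ₖ (1 : Matrix o o ℂ))ᴴ * (QvOp n M ⊗ₖ (1 : Matrix o o ℂ))) := by
    rw [vecOp, covLapC_const_one, lapC_eq_gram, Qcov_one]
  have hSu : vecOp n M a' Γ R = (freeGrad n M (o := o) + gradDefect n M R)ᴴ * (freeGrad n M (o := o) + gradDefect n M R)
      + ((a' * (n : ℝ) ^ d : ℝ) : ℂ) • ((Qcov n M Γ R)ᴴ * Qcov n M Γ R) := by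
    rw [vecOp, covLapC_eq_gram, stackM_covDc_eq]
  have h := coercive_gram_perturb hS₁ hSu (freeMass_posSemidef n M ha'.le) (coercive_vecOp_one n M ha' Γ) (opNorm_gradDefect_le n M hα hR)
    (opNorm_massDefect_le n M ha'.le hτ hT)
  have e : gammaA d a' / 2 - (Real.sqrt d * α) ^ 2 - a' * (Fintype.card o * τ * (2 + Fintype.card o * τ)) = gammaV (Fintype.card o) d a' α τ := by
    rw [gammaV, mul_pow, Real.sq_sqrt (Nat.cast_nonneg _)]
  rw [← e]; exact h

/-- `V_R` is Hermitian. [folklore] -/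
theorem vecOp_isHermitian (a' : ℝ) (Γ : ContourSystem d n M) (R : Fin d → (Tor (fine n M) × Fin d → Matrix o o ℂ)) :
    (vecOp n M a' Γ R).IsHermitian := by
  have h1 : (covLapC (fine n M) ((n : ℕ) : ℂ) R).IsHermitian := by
    rw [covLapC_eq_gram]; exact Matrix.isHermitian_conjTranspose_mul_self _
  have h2 : ((Qcov n M Γ R)ᴴ * Qcov n M Γ R).IsHermitian := Matrix.isHermitian_conjTranspose_mul_self _
  exact h1.add (h2.smul (by rw [IsSelfAdjoint, Complex.star_def, Complex.conj_ofReal]))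

/-- **`V_R` is invertible** when `gammaV > 0`. [folklore] -/
theorem isUnit_vecOp (ha' : 0 < a') (hα : 0 ≤ α) (hτ : 0 ≤ τ) (hR : ∀ ν i, ‖connM (fine n M) ((n : ℕ) : ℂ) R ν i‖ ≤ α)
    (hT : ∀ y j μ (t : Fin n), ‖transport (fine n M) R μ (Γ y j μ t) - 1‖ ≤ τ) (hγ : 0 < gammaV (Fintype.card o) d a' α τ) :
    IsUnit (vecOp n M a' Γ R) :=
  isUnit_of_coercive hγ (coercive_vecOp n M ha' hα hτ hR hT)

/-- **`‖V_R⁻¹‖ ≤ 1/gammaV`**. [folklore] -/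
theorem opNorm_vecOp_inv_le (ha' : 0 < a') (hα : 0 ≤ α) (hτ : 0 ≤ τ) (hR : ∀ ν i, ‖connM (fine n M) ((n : ℕ) : ℂ) R ν i‖ ≤ α)
    (hT : ∀ y j μ (t : Fin n), ‖transport (fine n M) R μ (Γ y j μ t) - 1‖ ≤ τ) (hγ : 0 < gammaV (Fintype.card o) d a' α τ) :
    ‖(vecOp n M a' Γ R)⁻¹‖ ≤ (gammaV (Fintype.card o) d a' α τ)⁻¹ :=
  opNorm_inv_le_of_coercive hγ (coercive_vecOp n M ha' hα hτ hR hT)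

end Background

end Summit.QuantumFields.BalabanUV.T4Continuum.CovariantVectorCoercive

end
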